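import Summits.ResolutionOfSingularities.ResolutionOfSingularities.Theorems.JetCutMixed
import HarnessLib

/-!
# JetCutMixed2 — decomp-res node «JetCut» (lens-2 g15 rev 5), file 2/2 of `JetCutMixed`

Content VERBATIM from the decomp-res lens-2 file `HOME/decomp-res-lens-2/g15/JetCut.lean` rev 5 (pin 9f53e5ca =
`parts/JetCut-rev5-9f53e5ca.lean`, 7 495 l;
HOME = run/shared/lean/pub/decomp-res; CRITIC-LEDGER rows 109 / 115 / 120 / 121 / 122 / 127 / 133 CLEARED; landing
order INBOX :231; the critic's
HYGIENE-landing.md h1–h11 applied — DOCSTRING-ONLY).  The lens's blocks RESTATED VERBATIM from lens-2 g12 / g13 /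
g14 (§R / §R13 / §R14) are DELETED:
they are the tree's `RelativeDeltaCut*` / `CurveLeafExit*` / `PinchCut*` modules (namespaces `RelativeDeltaCut`,
`CurveLeafExit`, `PinchCut`, opened;
the lens's `CurveLeafExitRestated.x` / `PinchCutRestated.x` are cited as `CurveLeafExit.x` / `PinchCut.x`, the three
pointwise engine edges of g12 as
`RelativeDeltaCut.x`).  Namespace `…Theorems.JetCut` (the lens's `Theses.JetCut` is gate-reserved), sub-namespaces
`Tame` / `Wide` / `Broad` / `Vast`
as in the lens; file split only (tree files ≤ 400 lines): sections, variables and every declaration exactly as in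
the lens, the long rev-0/1 prose
lives in HOME/decomp-res-lens-2/g15/NODE-g15.md §ARCHIVE-A (not in the tree).  Node files, in import order:
`JetCutJetKernels`, `JetCutPoint`, `JetCutClasses`, `JetCutKernels`, `JetCutTame`, `JetCutTameClasses`,
`JetCutTameKernels`, `JetCutLadder`, `JetCutWideClasses`, `JetCutWideKernels`, `JetCutMixed`, `JetCutBroadClasses`,
`JetCutBroadKernels`, `JetCutDegenerate`, `JetCutVastClasses`, `JetCutVastKernels`
(each possibly continued `…2`, `…3`), then the wiring `MaxContactCutJetCut*` (in the Theses cone).  All `--supports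
stmt-ResolutionOfSingularities-29273`
(`MaxContactCut.RungOne`); nothing closes 29273 — decided cells carry their engines as hypotheses, and exactly ONE
located-residual aside is booked on
the route for this column (`Vast.VastSpecialRung`, home `JetCutVastClasses`).

§M (rev 4): the MIXED LADDER (L′) — a DEPTH LAW with CLASS EXIT for tails led by a MIXED monomial `X₁^a W^b`: the
two-weight calculus `WtIdeal₂` and the mixed kernels (`mixed_chart_identity`, `mixed_weight_step`,
`mixed_sidechart_identity`, `mixed_depth`, PROVED), the FIBRE-MONOMIAL LEMMA **`not_purePower_of_fibre`** (`section
MixedField`, Mathlib-general, PROVED; HYGIENE h8), the mixed ring shape (HYGIENE h7), §M2 point level: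
`IsMixedLadderAt`, uniformly shaped curves, ENGINE (L′) `MixedLadderExit`, the BROAD leaf (B) = (W) ∪ (L′) with
`BroadExit`, the broad-special class and the pointwise kernels.

Part 2/2 carries: `isBroadCurvePt_of_isLadderCurvePt`, `isBroadCurvePt_of_isJetCurvePt`,
`isBroadCurvePt_of_isConeTailCurvePt`, `wideExit_of_broadExit`, `mixedLadderExit_of_broadExit`,
`jetTameExit_of_broadExit`, `ladderExit_of_broadExit`, `jetExit_of_broadExit`, `flatConeExit_of_broadExit`,
`isCurveExitPt_of_isMixedLadderCurvePt`, `isCurveExitPt_of_isBroadCurvePt`, `isWideSpecialPt_of_isBroadSpecialPt`,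
`isTameSpecialPt_of_isBroadSpecialPt`, `not_isBroadSpecialPt_of_isBroadCurvePt`, `SeqBGen`.

(Sources: HunekeSwanson2006 Cor. 5.5.5; CossartJannsenSaito2020 Ch. 2, Thm. 3.6/3.7, Ch. 8; CossartPiltant2008 Prop.
4.2; CossartPiltant2019 Rem. 3.2; Hironaka1964 Ch. III; Hironaka1967; Hironaka1977; Moh1987; Giraud1975.)
-/

open CategoryTheory AlgebraicGeometry TopologicalSpace IsLocalRing
open Literature.AlgebraicGeometry.Resolution
open Summit.ResolutionOfSingularities.ResolutionOfSingularities.Theorems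
open Summit.ResolutionOfSingularities.ResolutionOfSingularities.Theorems.WeakOrderReduction
open Summit.ResolutionOfSingularities.ResolutionOfSingularities.Theorems.DeltaFaceCutClasses
open Summit.ResolutionOfSingularities.ResolutionOfSingularities.Theorems.RelativeDeltaCut
open Summit.ResolutionOfSingularities.ResolutionOfSingularities.Theorems.CurveLeafExit
open Summit.ResolutionOfSingularities.ResolutionOfSingularities.Theorems.PinchCut

namespace Summit.ResolutionOfSingularities.ResolutionOfSingularities.Theorems.JetCut

/-- (L) ⊆ (B).  KERNEL (PROVED). [folklore] -/
theorem isBroadCurvePt_of_isLadderCurvePt {Y : Scheme.{0}} {I : Y.IdealSheafData} {n : ℕ} {y : Y} :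
    IsLadderCurvePt I n y → IsBroadCurvePt I n y :=
  fun h => Or.inl (Or.inr h)

/-- (J) ⊆ (B).  KERNEL (PROVED). [folklore] -/
theorem isBroadCurvePt_of_isJetCurvePt {Y : Scheme.{0}} {I : Y.IdealSheafData} {n : ℕ} {y : Y} :
    IsJetCurvePt I n y → IsBroadCurvePt I n y :=
  fun h => Or.inl (isWideCurvePt_of_isJetCurvePt h)

/-- (CT) ⊆ (B), marking `n ≥ 2`.  KERNEL (PROVED). [folklore] -/
theorem isBroadCurvePt_of_isConeTailCurvePt {Y : Scheme.{0}} {I : Y.IdealSheafData} {n : ℕ} (hn : 2 ≤ n) {y : Y} :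
    IsConeTailCurvePt I n y → IsBroadCurvePt I n y :=
  fun h => Or.inl (isWideCurvePt_of_isConeTailCurvePt hn h)

/-- ENGINE (B) gives ENGINES (W), (L′), (T), (L), (J), (C).  KERNEL (PROVED). [folklore] -/
theorem wideExit_of_broadExit (hB : BroadExit) : WideExit :=
  hB.1

/-- `mixedLadderExit_of_broadExit`: Auxiliary step of this node's calculus, VERBATIM from the lens file (see the
module docstring); the statement is its type. [folklore] -/
theorem mixedLadderExit_of_broadExit (hB : BroadExit) : MixedLadderExit :=
  hB.2

/-- `jetTameExit_of_broadExit`: Auxiliary step of this node's calculus, VERBATIM from the lens file (see the module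
docstring); the statement is its type. [folklore] -/
theorem jetTameExit_of_broadExit (hB : BroadExit) : JetTameExit :=
  hB.1.1

/-- `ladderExit_of_broadExit`: Auxiliary step of this node's calculus, VERBATIM from the lens file (see the module
docstring); the statement is its type. [folklore] -/
theorem ladderExit_of_broadExit (hB : BroadExit) : LadderExit :=
  hB.1.2

/-- `jetExit_of_broadExit`: Auxiliary step of this node's calculus, VERBATIM from the lens file (see the module
docstring); the statement is its type. [folklore] -/
theorem jetExit_of_broadExit (hB : BroadExit) : JetExit :=
  jetExit_of_wideExit hB.1

/-- `flatConeExit_of_broadExit`: Auxiliary step of this node's calculus, VERBATIM from the lens file (see the module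
docstring); the statement is its type. [folklore] -/
theorem flatConeExit_of_broadExit (hB : BroadExit) : FlatConeExit :=
  flatConeExit_of_wideExit hB.1

/-- Under ENGINE (L′), every mixed-ladder-curve point is a curve-exit point (the port's hypothesis shape).  KERNEL
(PROVED). [folklore] -/
theorem isCurveExitPt_of_isMixedLadderCurvePt {Y : Scheme.{0}} {I : Y.IdealSheafData} {n : ℕ} {y : Y}
    (hL : MixedLadderExit) (hY : Scheme.IsRegular Y) (hn : 2 ≤ n) (h : IsMixedLadderCurvePt I n y) :
    IsCurveExitPt I n y := by
  obtain ⟨η, a, b, hηy, hiso, hcurve⟩ := h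
  exact ⟨η, hηy, hcurve.1, hiso, hL Y hY I n hn a b η hcurve⟩

/-- Under ENGINE (B), every broad-curve point is a curve-exit point.  KERNEL (PROVED). [folklore] -/
theorem isCurveExitPt_of_isBroadCurvePt {Y : Scheme.{0}} {I : Y.IdealSheafData} {n : ℕ} {y : Y}
    (hB : BroadExit) (hY : Scheme.IsRegular Y) (hn : 2 ≤ n) (h : IsBroadCurvePt I n y) :
    IsCurveExitPt I n y := by
  rcases h with h | h
  · exact isCurveExitPt_of_isWideCurvePt hB.1 hY hn h
  · exact isCurveExitPt_of_isMixedLadderCurvePt hB.2 hY hn h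

/-- Broad-special ⇒ wide-special ⇒ tame-special ⇒ jet-special ⇒ pinch-special (the located class keeps shrinking).
KERNEL (PROVED). [folklore] -/
theorem isWideSpecialPt_of_isBroadSpecialPt {k : Type} [Field k] {Y : Scheme.{0}} {g : Y ⟶ Spec (.of k)}
    {hY : Scheme.IsRegular Y} {I : Y.IdealSheafData} {n : ℕ} {y : Y} (h : IsBroadSpecialPt g hY I n y) :
    IsWideSpecialPt g hY I n y :=
  ⟨h.1, fun hW => h.2 (Or.inl hW)⟩

/-- `isTameSpecialPt_of_isBroadSpecialPt`: Auxiliary step of this node's calculus, VERBATIM from the lens file (see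
the module docstring); the statement is its type. [folklore] -/
theorem isTameSpecialPt_of_isBroadSpecialPt {k : Type} [Field k] {Y : Scheme.{0}} {g : Y ⟶ Spec (.of k)}
    {hY : Scheme.IsRegular Y} {I : Y.IdealSheafData} {n : ℕ} {y : Y} (h : IsBroadSpecialPt g hY I n y) :
    IsTameSpecialPt g hY I n y :=
  isTameSpecialPt_of_isWideSpecialPt (isWideSpecialPt_of_isBroadSpecialPt h)

/-- A broad-curve point is never broad-special.  KERNEL (PROVED). [folklore] -/
theorem not_isBroadSpecialPt_of_isBroadCurvePt {k : Type} [Field k] {Y : Scheme.{0}} {g : Y ⟶ Spec (.of k)}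
    {hY : Scheme.IsRegular Y} {I : Y.IdealSheafData} {n : ℕ} {y : Y} (h : IsBroadCurvePt I n y) :
    ¬ IsBroadSpecialPt g hY I n y :=
  fun hs => hs.2 h

namespace Broad

/-! ### §M4 + §MK  sequence level and kernels: the BROAD cut, in the sub-namespace `Broad` — a MECHANICAL COPY of §J4 and
§K (via §L4/§LK) with the wide leaf (W) replaced by the broad leaf (B) (`IsWideCurvePt ↦ IsBroadCurvePt`,
`IsWideSpecialPt ↦ IsBroadSpecialPt`, `WideExit ↦ BroadExit`, names `SeqW… ↦ SeqB…`, `Wide…Rung ↦ Broad…Rung`). -/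

/-! ### §M4  The graded statements of the BROAD cut (mechanical copy of §J4 with the jet leaf (J) replaced by the
broad leaf (B) = wide ∪ mixed ladder) -/

/-- **`SeqBGen n`** — weak order reduction in dimension four at marking `n` for data ALL of whose top points are of
class ≥ 2, near-generic (g10), δ-generic (g11), curve-generic (g12), rel-curve-generic or flat-curve (g13), pinch-curve
or cone-curve (g14), or BROAD-CURVE points (g15 rev 4: jet-tame-, ladder- or mixed-ladder-curve).  [DECIDED-MOD-PORT
relative to `SeqDimFour 2 n`:
`bGenRungAt_of_engines`.]  STATEMENT SCHEMA. (Sources: BierstoneGrigorievMilmanWlodarczyk2011 §3.1; CossartPiltant2008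
Prop. 4.2; Hironaka1967.) -/
def SeqBGen (n : ℕ) : Prop :=
  ∀ p : ℕ, p.Prime → ∀ (k : Type) [Field k] [CharP k p]
    (Y : Scheme.{0}) (g : Y ⟶ Spec (.of k)), IsSeparated g → LocallyOfFiniteType g → QuasiCompact g →
    ∀ hY : Scheme.IsRegular Y, topologicalKrullDim Y ≤ 4 →
    ∀ I : Y.IdealSheafData, (∀ y : Y, idealOrder I y ≤ ((n : ℕ) : ℕ∞)) →
      (∀ y : Y, idealOrder I y = ((n : ℕ) : ℕ∞) →
        ClassGE g hY I n 2 y ∨ VeryNearCutClasses.IsNearGenericPt I n y ∨ IsDeltaGenericPt I n y ∨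
          IsCurveGenericPt I n y ∨ IsRelCurveGenericPt I n y ∨ IsFlatCurvePt I n y ∨
          IsPinchCurvePt I n y ∨ IsConeCurvePt I n y ∨ IsBroadCurvePt I n y) →
      ∃ t : CentreSeq Y, WeakResolution t (⟨I, [], n⟩ : MarkedIdeal Y)

end Broad

end Summit.ResolutionOfSingularities.ResolutionOfSingularities.Theorems.JetCut
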